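import Summits.HodgeConjecture.HodgeConjecture.Theorems.R90S6HeckeThreeTermRecursion       -- W8-g generic: `doubleCosetOperator_mul_pow_eq_of_contracting`, `_mul_self_eq_of_contracting`
import Literature.NumberTheory.Automorphic.HyperspecialUnitaryRankOneNotSquareIntegrable      -- ★ L1b: `exists_transversal_borelInt`, `exists_transversal_traceZero`, `heisMid_injective`; brings ★ L1 `torusGen`, `bijOn_heckeNeighbours`
import Literature.NumberTheory.Automorphic.UnitaryRankOneBasicHeckeOperator                    -- ★ m = 1: `satakeTransform_doubleCosetOperator_basic_three`, `heckeEigencharacter_doubleCosetOperator_basic_three`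
import Literature.NumberTheory.Automorphic.HyperspecialUnitarySatakeTransformAdicCompletion     -- ★ adic packaging: `unitaryHeckeEigencharacterAdic(_eq)`, `unramifiedLocalConjDatum_localConjUniformizer`
import Literature.NumberTheory.Automorphic.HyperspecialUnitarySatakeIsomorphismAdicCompletion    -- ★ `exists_galAdicCompletionMap_ne` (`σ_w ≠ id`), `isHeckeTriple_unitaryInt_adicCompletion`, `finite_residueField_adicCompletion`
import HarnessLib

/-!
# R90 · S6 — WAVE 8 card W8-g: MACDONALD'S RANK-ONE RECURRENCE FOR THE UNRAMIFIED `U(3)` — in the spherical Hecke algebra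
# `ℋ(U(σ,J₀)(K), K₀)`: `φ₁ · φ_m = φ_{m+1} + (√Q − 1) φ_m + Q² φ_{m−1}` (`φ_m = 1_{K₀ tᵐ K₀}`, `t = diag(ϖ, 1, ϖ⁻¹)`, `Q = #𝓀 = q_v²`),
# and its Satake and eigenvalue forms, generically and at an inert unramified place (`Theorems/R90S6MacdonaldRankOne.lean`)

Cell `hodgecm-mathlib`, crux H413 (`stmt-HodgeConjecture-24833`), route of record `HCCMUnconditional`; programme R90-TF, section S6 (base `R90-C14`),
seat R90-C14-p09 (g0); S6 WAVE 8 card W8-g (dealer R90-C14-plan (g2), R90 bus 2026-09-04T23:40:33Z ∕ 23:41:27Z), DAG r5 row E1.3.2.1 «CLOSED-FORM rank-one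
Satake transforms (Macdonald's formula on the `(q³+1, q+1)`-biregular tree of `U(3)_w` …): … only the explicit `𝒮(φ_m)` ∕ the recursion … remains».  Helper
lane `--supports stmt-HodgeConjecture-24833 --as helper`; THEOREMS ONLY (no definition, no instance, no notation, no named fact, no `sorry`); imports = W8-g
generic `Theorems.R90S6HeckeThreeTermRecursion` + ★ L1∕L1b `HyperspecialUnitaryRankOne{HeckeNeighbours,NotSquareIntegrable}` + ★ `UnitaryRankOneBasicHeckeOperator`
(m = 1) + ★ adic Satake files + HarnessLib (no `Cruxes` import).

THE PRINT.  [Macdonald1971, Ch. V §3]: on a semi-homogeneous tree with degrees `a + 1` (the vertex class of `o`) and `b + 1`, the Hecke operators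
`φ_m = 1_{K tᵐ K}` of the stabiliser `K` of `o` satisfy `φ₁ φ_m = φ_{m+1} + (b − 1) φ_m + ab·φ_{m−1}` (`m ≥ 2`), `φ₁² = φ₂ + (b−1) φ₁ + (a+1)b`, whence the
closed forms of the spherical functions ∕ Satake transforms; for the unramified quasi-split `U(3)(E_w ∕ F_v)` and its HYPERSPECIAL `K₀` one has
`(a, b) = (q_v³, q_v)` ([Tits1979] §2.10, §3.3.3; [BruhatTits1972] (4.4.3)–(4.4.4); in the tree `Q := #𝓀[E_w] = q_v²`, `√Q = q_v`, so `ab = Q²`, `b − 1 = √Q − 1`,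
`(a+1)b = Q² + √Q`).  [CartierCorvallis1979, §IV (4.2), Thm. 4.1, Cor. 4.2]: `𝒮` and the eigencharacters `λ_β` are algebra homomorphisms, `λ_{β₀} = deg`.
[Rogawski1990, §4.5 p. 50]: the unramified representations of `U(3)_w` and their Hecke eigenvalues.

WHAT IS PROVED (`hd : UnramifiedLocalConjDatum σ ϖ`, `σ ≠ id`, finite residue field `𝓀` of cardinality `Q`; `t = hd.torusGen = diag(ϖ, 1, ϖ⁻¹)`,
`φ_m = doubleCosetOperator K₀ (tᵐ)`, `K₀ = unitaryInt`; `tᵐ = diag(ϖᵐ, 1, ϖ⁻ᵐ)` by ★ `torusGen_pow_eq`):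
* §1 **`doubleCosetOperator_torusGen_mul_pow`** (`m ≥ 2`, any comm. ring `k`): `φ₁ · φ_m = φ_{m+1} + (√Q − 1) · φ_m + Q² · φ_{m−1}`;
  **`doubleCosetOperator_torusGen_mul_self`**: `φ₁ · φ₁ = φ₂ + (√Q − 1) · φ₁ + (Q² + √Q) · 1` — the generic W8-g theorem at the contracting transversal
  `R₊ t ∪ u(0, R₀) ∪ {t⁻¹}` (★ `bijOn_heckeNeighbours`, `|R₊| = Q²` ★ `exists_transversal_borelInt`, `|R₀| = √Q − 1` ★ `exists_transversal_traceZero`).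
* §2 `torusGen_eq_basic` (`t` = the element of ★ `UnitaryRankOneBasicHeckeOperator`), a light-carrier algebra-hom bookkeeping lemma, `natCast_sqrt_card_sub_one`.
* §3 **`satakeTransform_doubleCosetOperator_torusGen_pow_succ`**: `𝒮(φ_{m+1}) = Q·(x^{(1,0,−1)} + x^{(−1,0,1)})·𝒮(φ_m) − Q²·𝒮(φ_{m−1})` (`m ≥ 2`; with ★
  `satakeTransform_doubleCosetOperator_basic_three` `𝒮(φ₁) = Q·(x^{ℓ₁}+x^{ℓ₋₁}) + (√Q−1)` and `𝒮(φ₀) = 1` this GENERATES every `𝒮(φ_m)` as an explicit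
  `W`-invariant Laurent polynomial — the closed form of row E1.3.2.1); **`heckeEigencharacter_doubleCosetOperator_torusGen_pow_succ`**:
  `λ_β(φ_{m+1}) = Q(z + z⁻¹)·λ_β(φ_m) − Q²·λ_β(φ_{m−1})`, `z = β₀β₂⁻¹` (Macdonald's recurrence = the hypothesis `hrec` of ★ `RankOneRadial.…`).
* §4 the same at an inert unramified place `w` of a quadratic extension of number fields, in the S6 currency: `doubleCosetOperator_torusGen_mul_pow_adicCompletion`,
  **`unitaryHeckeEigencharacterAdic_torusGen_pow_succ`** (★ `unitaryHeckeEigencharacterAdic_eq`, ★ `isHeckeTriple_unitaryInt_adicCompletion`).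
NOT HERE: (i) the `U(2)_w` twin `φ₁ φ_m = φ_{m+1} + (q_v − 1) φ_m + q_v² φ_{m−1}` (W8-g′ — the generic theorem applies verbatim, but the tree has the contracting
transversal, L1 `bijOn_heckeNeighbours`, for `N = 3` only); (ii) the DEGREES `#(K₀ tᵐ K₀ ∕ K₀) = (Q² + √Q)·Q^{2(m−1)}` — they follow from §1 read by the trivial
eigencharacter ★ `heckeEigencharacter_trivialPoint_doubleCosetOperator`, but that closed form is the W8-b card (`ncard_orbit_torusGen_pow_three`, p03) ∕ p07's
`ncard_orbit_torusGen_pow_inert` — cite those by name once ★ (dealer ruling 2026-09-04T23:47:19Z «no public twin»).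
HONEST LABEL: local spherical Hecke-algebra structure constants; proves no printed global statement, discharges no citation; count-neutral helper until
E1.3.5.2.5 ∕ E1.4.4.2.3 consume it.  HC_CM is proved only modulo the 7 printed citations (2 remaining named inputs: hLiu418 = stmt-HodgeConjecture-24832,
h413 = stmt-HodgeConjecture-24833) until rung 0 closes; REL ≠ ★ ≠ BUILT.

## Tree search
★ L1 `torusGen`, `coe_torusGen`, `torusGen_pow_eq`, `conj_torusGen_mem_borelInt`, `inv_torusGen_mem_doubleCoset`, `disjoint_doubleCoset_torusGen_pow`,
`conj_torusGen_heisMid_mem_borelInt`, `bijOn_heckeNeighbours` [HyperspecialUnitaryRankOneHeckeNeighbours]; ★ L1b `exists_transversal_borelInt`,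
`exists_transversal_traceZero`, `heisMid_injective` [HyperspecialUnitaryRankOneNotSquareIntegrable]; ★ `satakeTransform_doubleCosetOperator_basic_three`,
`heckeEigencharacter_doubleCosetOperator_basic_three` [UnitaryRankOneBasicHeckeOperator :582 :621]; ★
`unitaryHeckeEigencharacterAdic_eq`, `unramifiedLocalConjDatum_localConjUniformizer`, `exists_galAdicCompletionMap_ne`, `isHeckeTriple_unitaryInt_adicCompletion`,
`finite_residueField_adicCompletion`.  Dedup: `rg "torusGen_mul_pow|MacdonaldRankOne|torusGen_pow_succ"` over `lean/` — no hit.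

## References
* [Macdonald1971] I. G. Macdonald, *Spherical functions on a group of p-adic type*, Ramanujan Inst. Publ. 2 (1971), Ch. V §3.
* [CartierCorvallis1979] P. Cartier, *Representations of 𝔭-adic groups: a survey*, PSPM 33.1 (1979), §IV (4.2)–(4.4), Thm. 4.1, Cor. 4.2.
* [BruhatTits1972] F. Bruhat, J. Tits, *Groupes réductifs sur un corps local I*, Publ. Math. IHÉS 41 (1972), (4.4.3)–(4.4.4).
* [Tits1979] J. Tits, *Reductive groups over local fields*, PSPM 33.1 (1979), §2.10, §3.3.3.
* [SerreTrees1980] J.-P. Serre, *Trees* (1980), II.1.1.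
* [Rogawski1990] J. D. Rogawski, *Automorphic Representations of Unitary Groups in Three Variables*, Ann. of Math. Stud. 123 (1990), §4.5 p. 50.
-/

set_option autoImplicit false
-- the mandated namespace repeats the single-problem summit's segment (`HodgeConjecture.HodgeConjecture`)
set_option linter.dupNamespace false

noncomputable section

open scoped Valued WithZero Matrix MatrixGroups Pointwise
open MulAction ConjAct Polynomial

namespace Summit.HodgeConjecture.HodgeConjecture.R90.S6

open Literature.NumberTheory.Automorphic Literature.NumberTheory.Automorphic.HermitianLattice
  Literature.NumberTheory.Automorphic.HermitianLattice.UnramifiedLocalConjDatum Literature.NumberTheory.Automorphic.CartanUnique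
  Literature.NumberTheory.Automorphic.SymplecticCartan Literature.NumberTheory.Automorphic.heckeAlgebra

variable {K : Type*} [Field K] [Valued K ℤᵐ⁰] {σ : K →+* K} {ϖ : K} [Finite 𝓀[K]]
  [IsHeckeTriple (⊤ : Submonoid (unitaryGroupOfForm σ ((StdForm.antidiagonal 3).over K))) (unitaryInt σ ((StdForm.antidiagonal 3).over K))
    (unitaryInt σ ((StdForm.antidiagonal 3).over K))]

/-! ## §1 The three-term recursion in `ℋ_k(U(3), K₀)` over any commutative ring `k` -/

section HeckeAlgebra

variable {k : Type*} [CommRing k]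

/-- **MACDONALD'S RECURRENCE IN THE HECKE ALGEBRA OF THE UNRAMIFIED `U(3)`, `m ≥ 2`.**  For `hd : UnramifiedLocalConjDatum σ ϖ` with `σ ≠ id`
and finite residue field `𝓀` of cardinality `Q` (`= q_w = q_v²`), `t = diag(ϖ, 1, ϖ⁻¹)` (★ `torusGen`) and `φ_m = 1_{K₀ tᵐ K₀} ∈ ℋ_k(U(σ,J₀)(K), K₀)`:
`φ₁ · φ_m = φ_{m+1} + (√Q − 1) · φ_m + Q² · φ_{m−1}` — the generic ★ `doubleCosetOperator_mul_pow_eq_of_contracting` at the contracting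
transversal `R₊ t ∪ u(0, R₀) ∪ {t⁻¹}` of `K₀ t K₀ ∕ K₀` (★ L1 `bijOn_heckeNeighbours`, `|R₊| = Q²` ★ `exists_transversal_borelInt`, `|R₀| = √Q − 1`
★ `exists_transversal_traceZero`): the radius-one pattern `(ab, b − 1, 1) = (q_v⁴, q_v − 1, 1)` of the `(q_v³ + 1, q_v + 1)`-biregular Bruhat–Tits tree seen
from its hyperspecial vertices. [cite: Macdonald1971, Ch. V §3] [cite: CartierCorvallis1979, §IV (4.2), Thm. 4.1] [cite: BruhatTits1972, (4.4.3)–(4.4.4)]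
[cite: SerreTrees1980, II.1.1] -/
theorem doubleCosetOperator_torusGen_mul_pow (hd : UnramifiedLocalConjDatum σ ϖ) (hσ : ∃ x : K, σ x ≠ x) {m : ℕ} (hm : 2 ≤ m) :
    doubleCosetOperator (k := k) (unitaryInt σ ((StdForm.antidiagonal 3).over K)) hd.torusGen *
        doubleCosetOperator (unitaryInt σ ((StdForm.antidiagonal 3).over K)) (hd.torusGen ^ m) =
      doubleCosetOperator (unitaryInt σ ((StdForm.antidiagonal 3).over K)) (hd.torusGen ^ (m + 1)) +
        ((Nat.sqrt (Nat.card 𝓀[K]) - 1 : ℕ) : k) • doubleCosetOperator (unitaryInt σ ((StdForm.antidiagonal 3).over K)) (hd.torusGen ^ m) +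
        ((Nat.card 𝓀[K] ^ 2 : ℕ) : k) • doubleCosetOperator (unitaryInt σ ((StdForm.antidiagonal 3).over K)) (hd.torusGen ^ (m - 1)) := by
  classical
  obtain ⟨Rp, hRp, hRp_inj, hRp_surj, hcardp⟩ := hd.exists_transversal_borelInt hσ
  obtain ⟨R0, hR0, hR0_inj, hR0_surj, hcard0⟩ := hd.exists_transversal_traceZero hσ
  have hX := hd.bijOn_heckeNeighbours hRp hRp_inj hRp_surj hR0 hR0_inj hR0_surj
  have h := doubleCosetOperator_mul_pow_eq_of_contracting (k := k)
    (KN := hd.borelLatticeU ⊓ unitaryInt σ ((StdForm.antidiagonal 3).over K)) (Xp := Rp.image (· * hd.torusGen)) (X0 := R0.image (heisMid σ))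
    inf_le_right (fun u hu => hd.conj_torusGen_mem_borelInt hu) hd.inv_torusGen_mem_doubleCoset (fun m n hmn => hd.disjoint_doubleCoset_torusGen_pow hmn)
    (fun x hx => ?_) (fun x hx => ?_) hX hm
  · rw [Finset.card_image_of_injective _ (mul_left_injective hd.torusGen), hcardp,
      Finset.card_image_of_injective _ (UnramifiedLocalConjDatum.heisMid_injective σ), hcard0] at h
    exact h
  · obtain ⟨u, hu, rfl⟩ := Finset.mem_image.1 hx
    rw [mul_inv_cancel_right]; exact hRp u hu
  · obtain ⟨y, hy, rfl⟩ := Finset.mem_image.1 hx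
    exact hd.conj_torusGen_heisMid_mem_borelInt (by rw [hR0 y hy, WithZero.exp_le_exp]; norm_num)

/-- **THE SQUARE OF THE BASIC HECKE OPERATOR** (`m = 1`): `φ₁ · φ₁ = φ₂ + (√Q − 1) · φ₁ + (Q² + √Q) · 1` — the last coefficient is the degree
`#(K₀ t K₀ ∕ K₀) = Q² + √Q = q_v⁴ + q_v` (★ `card_orbit_basic_three`). [cite: Macdonald1971, Ch. V §3] [cite: CartierCorvallis1979, §IV Thm. 4.1]
[cite: BruhatTits1972, (4.4.4)] -/
theorem doubleCosetOperator_torusGen_mul_self (hd : UnramifiedLocalConjDatum σ ϖ) (hσ : ∃ x : K, σ x ≠ x) :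
    doubleCosetOperator (k := k) (unitaryInt σ ((StdForm.antidiagonal 3).over K)) hd.torusGen *
        doubleCosetOperator (unitaryInt σ ((StdForm.antidiagonal 3).over K)) hd.torusGen =
      doubleCosetOperator (unitaryInt σ ((StdForm.antidiagonal 3).over K)) (hd.torusGen ^ 2) +
        ((Nat.sqrt (Nat.card 𝓀[K]) - 1 : ℕ) : k) • doubleCosetOperator (unitaryInt σ ((StdForm.antidiagonal 3).over K)) hd.torusGen +
        ((Nat.card 𝓀[K] ^ 2 + Nat.sqrt (Nat.card 𝓀[K]) : ℕ) : k) • 1 := by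
  classical
  obtain ⟨Rp, hRp, hRp_inj, hRp_surj, hcardp⟩ := hd.exists_transversal_borelInt hσ
  obtain ⟨R0, hR0, hR0_inj, hR0_surj, hcard0⟩ := hd.exists_transversal_traceZero hσ
  have hX := hd.bijOn_heckeNeighbours hRp hRp_inj hRp_surj hR0 hR0_inj hR0_surj
  have h := doubleCosetOperator_mul_self_eq_of_contracting (k := k)
    (KN := hd.borelLatticeU ⊓ unitaryInt σ ((StdForm.antidiagonal 3).over K)) (Xp := Rp.image (· * hd.torusGen)) (X0 := R0.image (heisMid σ))
    inf_le_right (fun u hu => hd.conj_torusGen_mem_borelInt hu) hd.inv_torusGen_mem_doubleCoset (fun m n hmn => hd.disjoint_doubleCoset_torusGen_pow hmn)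
    (fun x hx => ?_) (fun x hx => ?_) hX
  · rw [Finset.card_image_of_injective _ (mul_left_injective hd.torusGen), hcardp,
      Finset.card_image_of_injective _ (UnramifiedLocalConjDatum.heisMid_injective σ), hcard0] at h
    -- `Q² + (√Q − 1) + 1 = Q² + √Q` (`√Q ≥ 1`)
    have hs : 1 ≤ Nat.sqrt (Nat.card 𝓀[K]) := by
      haveI : Nonempty 𝓀[K] := ⟨0⟩
      exact Nat.succ_le_of_lt (Nat.sqrt_pos.2 Nat.card_pos)
    have e : Nat.card 𝓀[K] ^ 2 + (Nat.sqrt (Nat.card 𝓀[K]) - 1) + 1 = Nat.card 𝓀[K] ^ 2 + Nat.sqrt (Nat.card 𝓀[K]) := by omega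
    rw [e] at h
    exact h
  · obtain ⟨u, hu, rfl⟩ := Finset.mem_image.1 hx
    rw [mul_inv_cancel_right]; exact hRp u hu
  · obtain ⟨y, hy, rfl⟩ := Finset.mem_image.1 hx
    exact hd.conj_torusGen_heisMid_mem_borelInt (by rw [hR0 y hy, WithZero.exp_le_exp]; norm_num)

end HeckeAlgebra

/-! ## §2 The basic operator `t` in the coordinates of ★ `UnitaryRankOneBasicHeckeOperator`; linear bookkeeping -/

omit [Finite 𝓀[K]]
  [IsHeckeTriple (⊤ : Submonoid (unitaryGroupOfForm σ ((StdForm.antidiagonal 3).over K))) (unitaryInt σ ((StdForm.antidiagonal 3).over K))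
    (unitaryInt σ ((StdForm.antidiagonal 3).over K))] in
/-- `t = diag(ϖ, 1, ϖ⁻¹)` is the group element `diag(ϖ^{1·(1 − i)})` of ★ `UnitaryRankOneBasicHeckeOperator` (exponent vector `i ↦ 1 · (1 − i)` =
`(1, 0, −1)`). [cite: BruhatTits1972, (4.4.3)] -/
theorem torusGen_eq_basic (hd : UnramifiedLocalConjDatum σ ϖ) :
    hd.torusGen = (⟨zpowDiagGL (uniformizer_ne_zero hd.vϖ) (fun i : Fin 3 => (1 : ℤ) * (1 - (i : ℕ))),
      zpowDiagGL_mem_unitaryGroupOfForm hd.σϖ _ (rev_linear_three 1)⟩ : unitaryGroupOfForm σ ((StdForm.antidiagonal 3).over K)) := by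
  refine Subtype.ext ?_
  rw [coe_torusGen]
  congr 1
  funext i
  fin_cases i <;> simp

/-- Linear-combination bookkeeping for an algebra hom, `f (x + a • y + b • z) = f x + a • f y + b • f z` — stated over LIGHT carriers so that at
the Hecke algebra only unification (no class search) is needed. [folklore] -/
theorem algHom_apply_add_smul_add_smul {R A B : Type*} [CommSemiring R] [Semiring A] [Semiring B] [Algebra R A] [Algebra R B]
    (f : A →ₐ[R] B) (x y z : A) (a b : R) : f (x + a • y + b • z) = f x + a • f y + b • f z := by
  simp only [map_add, map_smul]

/-- `((√Q − 1 : ℕ) : ℂ) = √Q − 1` (`√Q ≥ 1` for a non-empty residue field). [folklore] -/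
theorem natCast_sqrt_card_sub_one :
    ((Nat.sqrt (Nat.card 𝓀[K]) - 1 : ℕ) : ℂ) = (Nat.sqrt (Nat.card 𝓀[K]) : ℂ) - 1 := by
  haveI : Nonempty 𝓀[K] := ⟨0⟩
  rw [Nat.cast_sub (Nat.succ_le_of_lt (Nat.sqrt_pos.2 Nat.card_pos)), Nat.cast_one]

/-! ## §3 Satake and eigenvalue forms (`k = ℂ`): `𝒮(φ_{m+1}) = Q·(x^{ℓ₁} + x^{ℓ₋₁})·𝒮(φ_m) − Q²·𝒮(φ_{m−1})` -/

/-- **MACDONALD'S RECURRENCE ON THE SATAKE SIDE** (`m ≥ 2`): `𝒮(φ_{m+1}) = Q·(x^{(1,0,−1)} + x^{(−1,0,1)})·𝒮(φ_m) − Q²·𝒮(φ_{m−1})` in `ℂ[ℤ³]`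
— the Hecke recursion through the algebra hom `𝒮` together with ★ `satakeTransform_doubleCosetOperator_basic_three` (`𝒮(φ₁) = Q·(x^{ℓ₁}+x^{ℓ₋₁}) + (√Q−1)`):
the two roots of the recurrence are `Q x^{ℓ₁}`, `Q x^{ℓ₋₁}`. [cite: Macdonald1971, Ch. V §3] [cite: CartierCorvallis1979, §IV (4.2), Thm. 4.1] -/
theorem satakeTransform_doubleCosetOperator_torusGen_pow_succ (hd : UnramifiedLocalConjDatum σ ϖ) (hσ : ∃ x : K, σ x ≠ x) {m : ℕ} (hm : 2 ≤ m) :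
    hd.satakeTransform (doubleCosetOperator (unitaryInt σ ((StdForm.antidiagonal 3).over K)) (hd.torusGen ^ (m + 1))) =
      ((Nat.card 𝓀[K] : ℂ) • (AddMonoidAlgebra.single (fun i : Fin 3 => (1 : ℤ) * (1 - (i : ℕ))) (1 : ℂ) +
          AddMonoidAlgebra.single (fun i : Fin 3 => (-1 : ℤ) * (1 - (i : ℕ))) 1)) *
        hd.satakeTransform (doubleCosetOperator (unitaryInt σ ((StdForm.antidiagonal 3).over K)) (hd.torusGen ^ m)) -
      ((Nat.card 𝓀[K] ^ 2 : ℕ) : ℂ) • hd.satakeTransform (doubleCosetOperator (unitaryInt σ ((StdForm.antidiagonal 3).over K)) (hd.torusGen ^ (m - 1))) := by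
  have h := congrArg hd.satakeTransform (doubleCosetOperator_torusGen_mul_pow (k := ℂ) hd hσ hm)
  rw [map_mul, algHom_apply_add_smul_add_smul, torusGen_eq_basic, hd.satakeTransform_doubleCosetOperator_basic_three hσ,
    ← torusGen_eq_basic hd, natCast_sqrt_card_sub_one] at h
  simp only [Algebra.smul_def] at h ⊢
  linear_combination -h

/-- **MACDONALD'S RECURRENCE FOR THE UNRAMIFIED EIGENVALUES** (`m ≥ 2`): for every torus parameter `β ∈ (ℂˣ)³` with `z = β₀β₂⁻¹`,
`λ_β(φ_{m+1}) = Q(z + z⁻¹)·λ_β(φ_m) − Q²·λ_β(φ_{m−1})` — the hypothesis `hrec` of ★ `RankOneRadial.not_summable_norm_sq_mul_sphere`, i.e. the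
Chebyshev-type recurrence whose solution is Macdonald's spherical function (★ `heckeEigencharacter_doubleCosetOperator_basic_three`:
`λ_β(φ₁) = Q(z + z⁻¹) + √Q − 1`). [cite: Macdonald1971, Ch. V §3] [cite: CartierCorvallis1979, §IV (4.2)–(4.4), Cor. 4.2] -/
theorem heckeEigencharacter_doubleCosetOperator_torusGen_pow_succ (hd : UnramifiedLocalConjDatum σ ϖ) (hσ : ∃ x : K, σ x ≠ x)
    (β : Fin 3 → ℂˣ) {m : ℕ} (hm : 2 ≤ m) :
    hd.heckeEigencharacter β (doubleCosetOperator (unitaryInt σ ((StdForm.antidiagonal 3).over K)) (hd.torusGen ^ (m + 1))) =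
      (Nat.card 𝓀[K] : ℂ) * ((β 0 : ℂ) * (β 2 : ℂ)⁻¹ + ((β 0 : ℂ) * (β 2 : ℂ)⁻¹)⁻¹) *
          hd.heckeEigencharacter β (doubleCosetOperator (unitaryInt σ ((StdForm.antidiagonal 3).over K)) (hd.torusGen ^ m)) -
        ((Nat.card 𝓀[K] ^ 2 : ℕ) : ℂ) * hd.heckeEigencharacter β (doubleCosetOperator (unitaryInt σ ((StdForm.antidiagonal 3).over K)) (hd.torusGen ^ (m - 1))) := by
  have h := congrArg (hd.heckeEigencharacter β) (doubleCosetOperator_torusGen_mul_pow (k := ℂ) hd hσ hm)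
  rw [map_mul, algHom_apply_add_smul_add_smul, torusGen_eq_basic, hd.heckeEigencharacter_doubleCosetOperator_basic_three hσ β,
    ← torusGen_eq_basic hd, natCast_sqrt_card_sub_one, smul_eq_mul, smul_eq_mul] at h
  linear_combination -h

/-! ## §4 At an inert unramified place `w ∣ v` of a quadratic extension `E ∕ F` (the S6 carriers `unitaryHeckeEigencharacterAdic`) -/

section Adic

open NumberField IsDedekindDomain Literature.NumberTheory.Automorphic.UnitaryGroup

variable {F E : Type} [Field F] [NumberField F] [Field E] [NumberField E] [Algebra F E] [Algebra.IsQuadraticExtension F E]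
  (c : E ≃ₐ[F] E) (hc1 : c ≠ 1) (v : HeightOneSpectrum (𝓞 F)) (w : PlacesOver E v) (hw : c • w.1 = w.1)
  (hv : Algebra.IsUnramifiedIn (𝓞 E) v.asIdeal)

/-- **MACDONALD'S RECURRENCE IN `ℋ(U(J₀,3)(E_w), K₀)` AT AN INERT UNRAMIFIED PLACE** (`m ≥ 2`, `k = ℂ`): with the tree's datum
`hd_w = unramifiedLocalConjDatum_localConjUniformizer c hc1 v w hw hv` (uniformiser `localConjUniformizer`), `t_w = hd_w.torusGen`, `Q = q_w = #𝓀[E_w]`: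
`φ₁ · φ_m = φ_{m+1} + (√Q − 1) · φ_m + Q² · φ_{m−1}` (★ `isHeckeTriple_unitaryInt_adicCompletion`, ★ `finite_residueField_adicCompletion`, ★
`exists_galAdicCompletionMap_ne`). [cite: Macdonald1971, Ch. V §3] [cite: CartierCorvallis1979, §IV Thm. 4.1] [cite: Rogawski1990, §4.5 p. 50] -/
theorem doubleCosetOperator_torusGen_mul_pow_adicCompletion {m : ℕ} (hm : 2 ≤ m) :
    haveI := isHeckeTriple_unitaryInt_adicCompletion c v w hw ((StdForm.antidiagonal 3).over (w.1.adicCompletion E))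
    doubleCosetOperator (k := ℂ) (unitaryInt (galAdicCompletionMap (L := E) c hw) ((StdForm.antidiagonal 3).over (w.1.adicCompletion E)))
          (unramifiedLocalConjDatum_localConjUniformizer c hc1 v w hw hv).torusGen *
        doubleCosetOperator (unitaryInt (galAdicCompletionMap (L := E) c hw) ((StdForm.antidiagonal 3).over (w.1.adicCompletion E)))
          ((unramifiedLocalConjDatum_localConjUniformizer c hc1 v w hw hv).torusGen ^ m) =
      doubleCosetOperator (unitaryInt (galAdicCompletionMap (L := E) c hw) ((StdForm.antidiagonal 3).over (w.1.adicCompletion E)))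
          ((unramifiedLocalConjDatum_localConjUniformizer c hc1 v w hw hv).torusGen ^ (m + 1)) +
        ((Nat.sqrt (Nat.card 𝓀[w.1.adicCompletion E]) - 1 : ℕ) : ℂ) •
          doubleCosetOperator (unitaryInt (galAdicCompletionMap (L := E) c hw) ((StdForm.antidiagonal 3).over (w.1.adicCompletion E)))
            ((unramifiedLocalConjDatum_localConjUniformizer c hc1 v w hw hv).torusGen ^ m) +
        ((Nat.card 𝓀[w.1.adicCompletion E] ^ 2 : ℕ) : ℂ) •
          doubleCosetOperator (unitaryInt (galAdicCompletionMap (L := E) c hw) ((StdForm.antidiagonal 3).over (w.1.adicCompletion E)))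
            ((unramifiedLocalConjDatum_localConjUniformizer c hc1 v w hw hv).torusGen ^ (m - 1)) := by
  haveI := Literature.NumberTheory.Automorphic.finite_residueField_adicCompletion E w.1
  haveI := isHeckeTriple_unitaryInt_adicCompletion c v w hw ((StdForm.antidiagonal 3).over (w.1.adicCompletion E))
  exact doubleCosetOperator_torusGen_mul_pow _ (exists_galAdicCompletionMap_ne c hc1 v w hw) hm

/-- **MACDONALD'S RECURRENCE FOR THE S6 EIGENCHARACTERS `unitaryHeckeEigencharacterAdic`** (`m ≥ 2`): for every torus parameter `β` with
`z = β₀β₂⁻¹`, `λ_β(φ_{m+1}) = q_w (z + z⁻¹)·λ_β(φ_m) − q_w²·λ_β(φ_{m−1})` at the inert unramified place `w` — the local input E1.3.2.1 of the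
`ξ̂_H(φ_m)` ∕ `b(φ_λ)` expansions (E1.3.5.2.5, E1.4.4.2.3). [cite: Macdonald1971, Ch. V §3] [cite: CartierCorvallis1979, §IV (4.2)–(4.4), Cor. 4.2]
[cite: Rogawski1990, §4.5 p. 50] -/
theorem unitaryHeckeEigencharacterAdic_torusGen_pow_succ (β : Fin 3 → ℂˣ) {m : ℕ} (hm : 2 ≤ m) :
    haveI := isHeckeTriple_unitaryInt_adicCompletion c v w hw ((StdForm.antidiagonal 3).over (w.1.adicCompletion E))
    unitaryHeckeEigencharacterAdic c hc1 v w hw hv β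
        (doubleCosetOperator (unitaryInt (galAdicCompletionMap (L := E) c hw) ((StdForm.antidiagonal 3).over (w.1.adicCompletion E)))
          ((unramifiedLocalConjDatum_localConjUniformizer c hc1 v w hw hv).torusGen ^ (m + 1))) =
      (Nat.card 𝓀[w.1.adicCompletion E] : ℂ) * ((β 0 : ℂ) * (β 2 : ℂ)⁻¹ + ((β 0 : ℂ) * (β 2 : ℂ)⁻¹)⁻¹) *
          unitaryHeckeEigencharacterAdic c hc1 v w hw hv β
            (doubleCosetOperator (unitaryInt (galAdicCompletionMap (L := E) c hw) ((StdForm.antidiagonal 3).over (w.1.adicCompletion E)))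
              ((unramifiedLocalConjDatum_localConjUniformizer c hc1 v w hw hv).torusGen ^ m)) -
        ((Nat.card 𝓀[w.1.adicCompletion E] ^ 2 : ℕ) : ℂ) *
          unitaryHeckeEigencharacterAdic c hc1 v w hw hv β
            (doubleCosetOperator (unitaryInt (galAdicCompletionMap (L := E) c hw) ((StdForm.antidiagonal 3).over (w.1.adicCompletion E)))
              ((unramifiedLocalConjDatum_localConjUniformizer c hc1 v w hw hv).torusGen ^ (m - 1))) := by
  haveI := Literature.NumberTheory.Automorphic.finite_residueField_adicCompletion E w.1
  haveI := isHeckeTriple_unitaryInt_adicCompletion c v w hw ((StdForm.antidiagonal 3).over (w.1.adicCompletion E))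
  rw [unitaryHeckeEigencharacterAdic_eq c hc1 v w hw hv (unramifiedLocalConjDatum_localConjUniformizer c hc1 v w hw hv) β]
  exact heckeEigencharacter_doubleCosetOperator_torusGen_pow_succ _ (exists_galAdicCompletionMap_ne c hc1 v w hw) β hm

end Adic

end Summit.HodgeConjecture.HodgeConjecture.R90.S6

end
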